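import Summits.CriticalPhenomena.CardyFormulaZ2.Theses.CardyBoundaryCoulombGas
import Summits.CriticalPhenomena.CardyFormulaZ2.Theorems.StripClusterRates.Negative.KacFromAboveFalse
import Literature.Probability.LatticeModels.RowStatePlanar
import Literature.Probability.Percolation.LatticeSymmetry

/-!
# Line `two-cluster-rate-is-stationary-gap` for crux `CardyBoundaryCoulombGas.StripClusterRates`
(stmt-CriticalPhenomena-13878)

Crux-plan skeleton (planner `planner-cruxplan-stmt-CriticalPhenomena-13878-two-cluster-rate-is--0`,
round 1, 2026-08-16; idea card `Cruxes/StripClusterRates/Ideas/two-cluster-rate-is-stationary-gap.md`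
(ideator 1; merged by the panel with `stochastic-sector-mixing-rate`), triage `TRIAGE-r1-{1,2,3}.md`:
pass × 3; line card `Lines/two-cluster-rate-is-stationary-gap.md`).

THE LINE. `StripClusterRates` asks for the two lengthwise decay rates of the free axis strip of
bond-`ℤ²` percolation at `p = 1/2` — `γ₁(n)` of "one spanning cluster" (`crossingProb half m n`) and
`γ₂(n)` of "two distinct spanning clusters" — and for their Kac asymptotics `n·γ₁(n) → π/3 = π·h_{1,3}`,
`n·γ₂(n) → 2π = π·h_{1,5}`. The line reads BOTH rates off the ONE stochastic matrix already in the
tree, the planar `⋆`-chain `planarTransfer (Finset.Icc 0 n)` (`RowStatePlanar.lean`: one row step of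
percolation acting on non-crossing connectivity patterns of the `n+1` row sites and the bottom arc `⋆`;
rows sum to `1`, `sum_planarTransfer_eq_one`). That matrix is block upper-triangular in "is some site
joined to `⋆`": the MARKED block (transient: the cluster of the wired bottom row is still alive) and
the UNMARKED block (recurrent, itself stochastic: `⋆` is joined to nothing, Catalan-many patterns — the
stationary connectivity chain of the free strip, `≅ T|W⁰`).
* `γ₁(n)` is the ESCAPE RATE of the chain from the marked block: `e^{-γ₁(n)}` is the Perron root
  (spectral radius) of the marked block — `p₁(m,n) = P_wired[marked at time m]` EXACTLY (transposition
  `real_tbCrossing` + the row-transfer dictionary), the block is irreducible, and the tree's proved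
  Perron–Frobenius fact `DingZhou2009_thm_2_6_holds` gives `c_n ρ^m ≤ p₁ ≤ C_n ρ^m`.
* `γ₂(n)` is the RELAXATION RATE of the stationary chain: `e^{-γ₂(n)}` is the second-largest
  eigenvalue modulus (SLEM) of the unmarked block — THE LEVER of the card. Dictionary (verified exactly
  on six rectangles, `compute/dictionary_check.out`; `p₂(2,2) = 39/1024` = Disproof §4):
  `p₂(m,n) = E_{H₀} P[X_m^{alljoined} ≠ X_m^{horizRel H₀ free}]`, the grand (same-edges, monotone) coupling
  of the UNMARKED chain started from its top pattern (all sites joined, `⋆` apart) and from the random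
  bottom row; the `⋆`-forgetting map is `rowStep`-equivariant, which is why no marked mode (rate `γ₁ < γ₂`)
  enters; then `c s^m ≤ P[disagree] ≤ C_n m^k s^m` with `s` = SLEM (lower: a SLEM-eigenvector is
  non-constant and every function on a finite poset is a difference of two monotone ones; upper: Gelfand's
  formula for `U - 1π` on the block). The representation-theoretic reading of the card (Loewy `W⁰ ≃ L⁰ → L⁴`
  at `β = 1`, SLEM `=` Perron root of `T|W⁴`) is a corollary the line does not need.
* The VALUES are then two spectral-asymptotics statements about explicit rational matrices:
  `n·(-log ρ_marked(n)) → π/3` (S3) and `n·(-log SLEM_unmarked(n)) → 2π` (S4, hardest; the card's transfer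
  target in the sector where the Perron value is exactly `1`). Numerically (Disproof §4, n ≤ 12/11, and
  this seat's `compute/starchain_n5.out`, n ≤ 5, to 1e-12): `ρ_marked = e^{-γ₁}`, `SLEM = e^{-γ₂}`, both
  `n·γ` increasing towards the Kac values from BELOW (honours `Negative.KacFromAboveFalse`).

REGISTERED STUBS — RESHAPED by the line lead (prover-line-stmt-CriticalPhenomena-13878-0, 2026-08-16; see
the section "Reshape by the line lead" below for the seven registered stubs, their sizes and the proved glue).
The planner's four statements S1–S4 are KEPT as named intermediate statements (`OneClusterRateIsEscapeRate`,
`TwoClusterRateIsRelaxationRate`, `EscapeRateKac`, `RelaxationRateKac`): S1 and S2 are now DERIVED (no `sorry`)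
from the dictionary / reachability / spectral stubs D1, D2, S1', D3, S2a, S2b, and S3 ∧ S4 is the single
lead-held stub K = `stub_kacGapAsymptotics`.  Every stub is stated over TREE VOCABULARY ONLY
(`crossingProb`, `half`, `bondPercolation`, `zdGraph`, `leftSide/rightSide/rectangle`, `openConnIn`,
`PlanarRowState`, `planarTransfer`, `planarRowStep`, `hEdges`, `RowState.JoinedToStar`, `RowState.free`,
`Fintype.piFinset`, `List.foldl`, Mathlib) so that each lands verbatim as
`Summits/CriticalPhenomena/CardyFormulaZ2/Theorems/CardyBoundaryCoulombGasStripClusterRates<Stub>.lean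
--supports stmt-CriticalPhenomena-13878` in THIS namespace; the named `def`s are READABLE COPIES certified
equal to the stubs by the `*_holds` theorems, and `Registered.stub_*` are the name-keyed aliases the skeleton
audit admits as hypotheses of `StripClusterRates_of`.  Planner's original list, for reference:
* S1 `OneClusterRateIsEscapeRate`     (M/L) — `γ₁(n)` exists and `e^{-γ₁(n)}` = Perron root of the marked block;
* S2 `TwoClusterRateIsRelaxationRate` (L)   — `γ₂(n)` exists and `e^{-γ₂(n)}` = SLEM of the unmarked block;
* S3 `EscapeRateKac`                  (open-problem) — `n·(-log ρ_marked(n)) → π/3`;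
* S4 `RelaxationRateKac`              (open-problem, HARDEST) — `n·(-log SLEM_unmarked(n)) → 2π`.

DISPROOF USED (`Cruxes/StripClusterRates/Disproof.lean`, cdisprove cycle 1, NO KILL; landed
`Theorems/StripClusterRates/Negative/KacFromAboveFalse.lean`, imported here so the scratch check sees it):
there is NO `_false_without_<H>` theorem (§1: the only hypothesis `1 ≤ n` is not load-bearing) — nothing
to honour by a dedicated stub; `1 ≤ n` is kept in S1–S4 because at width `0` the unmarked block is `1×1`
and has no eigenvalue `≠ 1` (S2's SLEM clause would be unsatisfiable). `Negative.not_kacLowerBoundEveryWidth_one/_two`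
(Kac values are NOT lower bounds at small widths) — RESPECTED: S3/S4 claim `π/3`, `2π` only as `n → ∞`
limits, and S1/S2 give the refuter's exact anchors as corollaries (`γ₂(1) = 3 log 2`: the unmarked block at
`n = 1` is `[[5/8,3/8],[1/2,1/2]]`, SLEM `1/8`; `γ₁(1) = log(8/(3+√5))`: Perron root `(3+√5)/8` of the
`3×3` marked block) — i.e. the line CLOSES the Disproof's §6 near-misses `rate₂_width_one`,
`rate₁_width_one` once S1/S2 land. No stub is an instance of a landed Negative lemma (none is a per-width
Kac bound; none is `StripClusterRates` with a hypothesis dropped). Negatives index (8 items; CardyFormulaZ2: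
stmt-0748, stmt-6949): no contact.
-/

noncomputable section

namespace Summit.CriticalPhenomena.CardyFormulaZ2.Cruxes.StripClusterRates.TwoClusterRateIsStationaryGap

open Filter Topology
open scoped BigOperators Classical
open Literature.Probability.Percolation Literature.Probability.LatticeModels

/-! ## Vocabulary (readable local names; the registered stubs inline all of them) -/

/-- The columns `{0,…,n}` of the chain = the `n+1` ROWS of the crux's rectangle `[0,m]×[0,n]` after the
transposition `(x,y) ↦ (y,x)` of `ℤ²` (`real_tbCrossing`); chain time = crux length `m`. -/
abbrev cols (n : ℕ) : Finset ℤ := Finset.Icc (0 : ℤ) n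

/-- `γ` is the one-cluster lengthwise rate of width `n` (first `Tendsto` of the crux). -/
def OneClusterRate (n : ℕ) (γ : ℝ) : Prop :=
  Tendsto (fun m : ℕ ↦ -Real.log (crossingProb half m n) / (m : ℝ)) atTop (𝓝 γ)

/-- The crux's second event, verbatim: two open LR crossings of `[0,m]×[0,n]` in distinct open clusters
of the rectangle. -/
def twoClusterEvent (m n : ℕ) : Set (BondConfig (Site 2)) :=
  {ω | ∃ x₁ ∈ (leftSide m n : Set (Site 2)), ∃ y₁ ∈ (rightSide m n : Set (Site 2)),
    ∃ x₂ ∈ (leftSide m n : Set (Site 2)), ∃ y₂ ∈ (rightSide m n : Set (Site 2)),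
      ω ∈ openConnIn (rectangle m n : Set (Site 2)) x₁ y₁ ∧
      ω ∈ openConnIn (rectangle m n : Set (Site 2)) x₂ y₂ ∧
      ω ∉ openConnIn (rectangle m n : Set (Site 2)) x₁ x₂}

/-- `γ` is the two-cluster lengthwise rate of width `n` (second `Tendsto` of the crux). -/
def TwoClusterRate (n : ℕ) (γ : ℝ) : Prop :=
  Tendsto (fun m : ℕ ↦ -Real.log ((bondPercolation (zdGraph 2) half).real (twoClusterEvent m n)) /
    (m : ℝ)) atTop (𝓝 γ)

/-- `(μ, v)` is an eigenpair of the MARKED block of `planarTransfer (cols n)` (patterns with some site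
joined to `⋆`): `v` is supported on marked patterns, `v ≠ 0`, and the block eigen-equation holds row by
row (for a marked row `p` the full sum `∑_q T p q v q` IS the block sum, `v` vanishing off the block). -/
def IsMarkedEigenpair (n : ℕ) (μ : ℂ) (v : PlanarRowState (cols n) → ℂ) : Prop :=
  v ≠ 0 ∧ (∀ p, (∀ x, ¬ p.1.JoinedToStar x) → v p = 0) ∧
    ∀ p, (∃ x, p.1.JoinedToStar x) → ∑ q, (planarTransfer (cols n) p q : ℂ) * v q = μ * v p

/-- `(μ, v)` is an eigenpair of the UNMARKED block of `planarTransfer (cols n)` (the stationary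
connectivity chain: `⋆` joined to no site; from such a pattern the chain never charges a marked one). -/
def IsUnmarkedEigenpair (n : ℕ) (μ : ℂ) (v : PlanarRowState (cols n) → ℂ) : Prop :=
  v ≠ 0 ∧ (∀ p, (∃ x, p.1.JoinedToStar x) → v p = 0) ∧
    ∀ p, (∀ x, ¬ p.1.JoinedToStar x) → ∑ q, (planarTransfer (cols n) p q : ℂ) * v q = μ * v p

/-- `r` is the ESCAPE MODULUS of width `n`: the spectral radius (Perron root) of the marked block. -/
def IsEscapeModulus (n : ℕ) (r : ℝ) : Prop :=
  (∃ (μ : ℂ) (v : PlanarRowState (cols n) → ℂ), IsMarkedEigenpair n μ v ∧ ‖μ‖ = r) ∧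
    ∀ (μ : ℂ) (v : PlanarRowState (cols n) → ℂ), IsMarkedEigenpair n μ v → ‖μ‖ ≤ r

/-- `s` is the RELAXATION MODULUS of width `n`: the second-largest eigenvalue modulus (SLEM) of the
unmarked (stochastic) block — the largest `‖μ‖` over its eigenvalues `μ ≠ 1`. -/
def IsRelaxationModulus (n : ℕ) (s : ℝ) : Prop :=
  (∃ (μ : ℂ) (v : PlanarRowState (cols n) → ℂ), IsUnmarkedEigenpair n μ v ∧ μ ≠ 1 ∧ ‖μ‖ = s) ∧
    ∀ (μ : ℂ) (v : PlanarRowState (cols n) → ℂ), IsUnmarkedEigenpair n μ v → μ ≠ 1 → ‖μ‖ ≤ s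

/-! ## Named statements (readable copies; the registered stubs below restate them verbatim) -/

/-- S1 · ONE-CLUSTER RATE = ESCAPE RATE (the `k = 1` half of the route's foreseen `RateIsGap`; provable
now). For every width `n ≥ 1` the rate `γ₁(n) = lim -log p₁(m,n)/m` EXISTS and `e^{-γ₁(n)}` is the Perron
root of the marked block. Proof sketch: (i) dictionary `p₁(m,n) = crossingProb half m n = P(TB crossing of
[0,n]×[0,m])` (`real_tbCrossing`) `= (planarBoundary ᵥ* T^m) ⬝ planarReadout` — the law of the row-`m`
connectivity pattern inside the rectangle with the bottom row wired is the `⋆`-chain at time `m` started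
from `wired` (induction on `m` over `rowStep O H`; the informal item RowTransferExactness of route
CardyPolygonWords), and "some site joined to `⋆`" = "row `m` meets the cluster of row `0`"; (ii) the
readout mass is `δ_wired M^m 1` for the marked block `M ≥ 0`; (iii) `M` is IRREDUCIBLE on the planar
marked patterns: every marked pattern reaches `wired` in ONE step (all edges open) and `wired` reaches
every planar marked pattern (induction on the gaps of the `⋆`-block: its columns open vertically from the
wired row, the sub-partition inside each gap realised by the inductive hypothesis in the top rows above
closed edges; checked n ≤ 5, `compute/starchain_n5.out`), so the tree's PROVED Perron–Frobenius fact
`Literature.LinearAlgebra.Matrix.DingZhou2009_thm_2_6_holds` gives `r > 0`, a positive eigenvector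
`Mx = r x` and the domination `‖μ‖ ≤ r` of every complex eigenpair — i.e. the inlined "escape modulus"
clause with `μ = r`; (iv) two-sided bound `r^m · x(wired)/max x ≤ δ_wired M^m 1 ≤ r^m · x(wired)/min x`
(from `M^m x = r^m x`, `x > 0`), so `-log p₁(m,n)/m → -log r` with an `O(1/m)` error: the limit EXISTS and
`e^{-γ₁} = r`. Corollary: `γ₁(1) = log(8/(3+√5))` (Disproof §6 `rate₁_width_one`). Size M/L (the dictionary
induction is the bulk; Perron–Frobenius is in the tree). [BondesanJacobsenSaleur2012 §2, §5.1; Cardy2001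
§7.1; BlöteNightingale1982; DingZhou2009 Thm 2.6] -/
def OneClusterRateIsEscapeRate : Prop :=
  ∀ n : ℕ, 1 ≤ n → ∃ γ : ℝ, OneClusterRate n γ ∧ IsEscapeModulus n (Real.exp (-γ))

/-- S2 · TWO-CLUSTER RATE = RELAXATION RATE — THE LEVER (card C⁺ part 1, `StationaryGapIsTwoClusterRate`,
in elementary eigenpair language and with existence of the rate included). For every `n ≥ 1`,
`γ₂(n) = lim -log p₂(m,n)/m` EXISTS and `e^{-γ₂(n)}` is the SLEM of the unmarked block. Proof sketch
(probabilistic route (P) of the card, made exact by this seat): (i) `twoClusterEvent = disagreementEvent`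
(wired-vs-free disagreement of the far-side pattern; PROVED, `SketchIdeator1.disagreementEvent_eq_twoClusterEvent`);
(ii) the `⋆`-forgetting map `Φ` (restrict the partition to the sites, `⋆` a singleton) satisfies
`Φ ∘ rowStep O H = rowStep O H ∘ Φ`, so the site pattern of the wired chain is the UNMARKED chain started
from `Φ(wired) = alljoined`; hence `p₂(m,n) = E_{H₀} P[X_m^{alljoined} ≠ X_m^{horizRel H₀ free}]` under the
same-edges coupling (checked EXACTLY against the literal events on `(m,n) ∈ {(1,1),(2,1),(3,1),(1,2),(2,2),(1,3)}`,
`compute/dictionary_check.out`), and `2^{-n} d(m) ≤ p₂(m,n) ≤ d(m)`, `d(m) := P[X_m^{alljoined} ≠ X_m^{free}]`,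
by monotonicity of `rowStep` in the refinement order (`vertRel_mono`, `le_horizRel`); (iii) SANDWICH for the
monotone grand coupling of a finite chain with top and bottom: `d(m) ≤ ∑_{y<y'} (U^m f_{yy'})(top) - (U^m f_{yy'})(bot)
≤ C_n ‖(U - 1π)^m‖` (`f_{yy'} = 1{y ∼ y'}` increasing; Gelfand ⇒ rate `≥ -log s`), and for a SLEM eigenpair
`Uv = μv`, `μ ≠ 1` (so `v` non-constant; write `Re v`, `Im v` as differences of increasing functions on the
finite lattice of patterns; for `x, y` arbitrary compare both with `bot`, using `X^bot ≤ X^x ≤ X^top`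
pathwise): `s^m · osc(v) ≤ C'_n d(m)` (rate `≤ -log s`). So the limit exists and equals `-log s`;
`0 < s < 1` and `spec(U - 1π) = spec(U) ∖ {1} ∪ {0}` because the block `U` is stochastic
(`sum_planarTransfer_eq_one` + no unmarked → marked transition) and IRREDUCIBLE APERIODIC on ALL planar
unmarked patterns: `free` is reached from anywhere in one step (all vertical edges closed), and every
non-crossing partition of the sites is reached from `free` (induction on the gaps of the block of site `0`:
one bottom row of open horizontal edges under that block, its columns open vertically, each gap's
sub-partition realised inductively in the top rows above closed edges; checked n ≤ 5, 132/132 at n = 5).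
Corollary: `γ₂(1) = 3 log 2` (block `[[5/8,3/8],[1/2,1/2]]`, SLEM `1/8`;
Disproof §6 `rate₂_width_one`). The Loewy reading (`rad W⁰ ≅ L⁴` at `β = 1`, SLEM = Perron root of `T|W⁴`,
MDKP2017 §3.2, RidoutSaintAubin2014) is NOT needed. Size L. [LevinPeresWilmer2009 §12.2 and Cor. 12.6
(spectral form of mixing), Prop. 4.7/§5 (grand coupling); BondesanJacobsenSaleur2012 p. 16;
MorinDuchesneKlumperPearce2017 §3.2; arXiv:1204.4505] -/
def TwoClusterRateIsRelaxationRate : Prop :=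
  ∀ n : ℕ, 1 ≤ n → ∃ γ : ℝ, TwoClusterRate n γ ∧ IsRelaxationModulus n (Real.exp (-γ))

/-- S3 · KAC ASYMPTOTICS OF THE ESCAPE RATE (`h_{1,3} = 1/3`): `n·(-log ρ_marked(n)) → π/3`. Equivalent,
given S1, to the `γ₁` clause of the crux (uniqueness of limits) — the gain is the venue: `ρ_marked(n)` is the
Perron root of an explicit nonnegative rational matrix, with the two-sided Collatz–Wielandt bounds
`min_p (Mv)_p/v_p ≤ ρ ≤ max_p (Mv)_p/v_p` from ONE positive test vector, monotone in the block (domain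
monotonicity), and in the Temperley–Lieb(`β=1`) link basis it is the Perron root of
`2^{-(2n+1)}∏(1+e_{2j})∏(1+e_{2j-1})` on the standard module `W₂` (BJS §5.5; tree `transferLin_eq_noncommProd`).
Known mechanisms (all still to be made rigorous, none owned by this line): the brick matrix is a RATIO
`t(v₁)⁻¹t(v₀)` of Sklyanin's commuting open STAGGERED transfer matrices (light-cone lattice; it is NOT in
MDKP's homogeneous family `D(u)` — triage F2, `[B,H] ≠ 0`), so open-chain Bethe ansatz at `Δ = -1/2` with
inhomogeneities (card doubled-bethe-kozlowski, re-sited) or the diagonal-strip `D(π/6)` + `D₃` Y-system/TBA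
(cards vesica-zero-free-perron-branch, scaling-tba-positive-logs) transported to the axis strip by
`dkkmo_crossing_rotation_invariance` (card diagonal-strip-dkkmo-transfer) and pulled back through S1.
Numerics: `n·(-log ρ) = 0.42387, 0.60763, 0.70893, 0.77275, 0.81651, …, 0.93872` (n = 1..12), slopes of
`1/(-log ρ)` ↑ `3/π` (Disproof §4; this seat n ≤ 5). Claimed ONLY as a limit, approached from below
(`Negative.not_kacLowerBoundEveryWidth_one`). Size: open-problem. [Cardy1998 eq. (bb); CardyJPhysA1992;
MorinDuchesneKlumperPearce2017 §3.7; DegierEtAl2005 §3.1; Kozlowski2018; DKKMT2022; arXiv:1207.7005 §5.5] -/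
def EscapeRateKac : Prop :=
  ∀ r : ℕ → ℝ, (∀ n : ℕ, 1 ≤ n → IsEscapeModulus n (r n)) →
    Tendsto (fun n : ℕ ↦ (n : ℝ) * -Real.log (r n)) atTop (𝓝 (Real.pi / 3))

/-- S4 · KAC ASYMPTOTICS OF THE RELAXATION RATE (`h_{1,5} = 2`) — the card's transfer target, HARDEST:
`n·(-log SLEM_unmarked(n)) → 2π`. Equivalent, given S2, to the `γ₂` clause; the gain (card "Transfer",
triage-sharpened): the object is a genuinely STOCHASTIC matrix with Perron value exactly `1`, so the
quantity is a relaxation rate with two-sided characterisations that need one good test object rather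
than a diagonalisation — `SLEM = lim d(m)^{1/m}` for the monotone coupling (S2); from ABOVE, `SLEM ≤` the
contraction factor of an explicit metric on patterns under that coupling (`γ₂ ≥ …`); from BELOW, Wilson's
lemma: one explicit near-eigenfunction `Φ` with small defect `‖UΦ - λΦ‖` forces `SLEM ≥ λ - (defect term)`
(`γ₂ ≤ …`; the CFT says `Φ` = lattice `h_{1,5}` field = "two distinct clusters through the row", a quadratic
functional of the pattern); sharpness needs `Φ_n`, metric with factors `e^{-2π/n + o(1/n)}`. Reversibility is NOT available
(the chain is non-reversible) and — triage r1-1/2/3 — the EXACT Razumov–Stroganov/qKZ stationary law and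
the size recursion belong to the DIAGONAL chain `D(π/6)|W⁰` of MDKP, not to this axis chain (whose
stationary law is layer-order dependent, `compute/stationary_vs_RS.py` of triager 1; conjecturally the
STAGGERED specialisation of the inhomogeneous open qKZ solution — unverified, the lead's cheapest next
check). Alternative feeds as for S3 (Bethe `d = 4` sector / diagonal TBA subcase B + DKKMO loop form +
S2 backwards). Calibration target on the way (card stochastic-sector-mixing-rate C¹, triage r1-2 E1):
odd site numbers, `W₁ ⊃ I₃`, `N·gap → π`. Numerics: `n·(-log SLEM) = log 8, 3.22756, 3.91744, 4.36862,
4.68305, …, 5.49848` (n = 1..11), slopes of `1/(-log SLEM)` ↑ `1/(2π)`, slope ratio → 6 (pure stiffness: 4)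
(Disproof §4; this seat n ≤ 5 to 1e-12). Claimed ONLY as a limit (`Negative.not_kacLowerBoundEveryWidth_two`:
`n·γ₂(n) < 2π` for `n ≤ 3`). Size: open-problem. [Cardy1998 eq. (bb); MorinDuchesneKlumperPearce2017 §3.7
(d = 4, subcase B); DegierEtAl2005 §3.1/§6; PasquierSaleur1990; LevinPeresWilmer2009 §13.2 (Wilson's
method); DiFrancescoZinnJustin2005 (math-ph/0410061); arXiv:1610.04006] -/
def RelaxationRateKac : Prop :=
  ∀ s : ℕ → ℝ, (∀ n : ℕ, 1 ≤ n → IsRelaxationModulus n (s n)) →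
    Tendsto (fun n : ℕ ↦ (n : ℝ) * -Real.log (s n)) atTop (𝓝 (2 * Real.pi))


/-! ## Reshape by the line lead (prover-line-stmt-CriticalPhenomena-13878-0, 2026-08-16)

Same composition idea, seven registered stubs (`stubs_max`): the firm stubs S1/S2 are split into a
PERCOLATION ↔ CHAIN DICTIONARY part, a REACHABILITY part and a pure SPECTRAL part (so that independent
workers run in parallel on well-sized targets), and the two open-problem value stubs S3 ∧ S4 are merged into
the single stub `stub_kacGapAsymptotics` (the route's foreseen `KacGapAsymptotics`, `d = 2, 4`), held by the
lead.  Common currency between the percolation side and the spectral side is the COUNTING form of the chain: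
sequences `seq : Fin m → Finset S × Finset S` of (vertical, horizontal) bond configurations with
`seq t ∈ univ ×ˢ (hEdges S).powerset` (exactly the normalisation of `PercolationRowTransfer`), iterated by
`List.foldl` over `planarRowStep` from a deterministic start.

* D1 `stub_oneClusterDictionary` (L) — `crossingProb half m n` = fraction of sequences whose iterate from the
  WIRED state has some site joined to `⋆` (row-transfer exactness for the one-arc readout).
* D2 `stub_planarReachable` (L) — every planar MARKED state is an iterate of the wired state and every planar
  UNMARKED state is an iterate of the free state (the "gap induction"/comb construction; with the one-step
  facts "marked → wired", "anything → free" proved by the spectral workers this is irreducibility of the two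
  blocks).
* S1' `stub_oneClusterSpectral` (M) — D1 → D2(marked) → S1 (Perron–Frobenius `DingZhou2009_thm_2_6_holds` on
  the marked block + squeeze).
* D3 `stub_twoClusterDictionary` (L) — `c · dis n m ≤ p₂(m,n) ≤ dis n m`, `dis n m` = fraction of sequences on
  which the iterates from ALLJOINED (`⋆` apart) and from FREE disagree (grand coupling; the event identity
  `disagreement = two clusters`, `Φ`-equivariance of `⋆`-forgetting, monotonicity for the random free start).
* S2a `stub_relaxationUpper` (L) — spectral structure of the unmarked block: an SLEM `s` exists (some unmarked
  eigenpair `μ ≠ 1` has `‖μ‖ = s`, all have `‖μ‖ ≤ s`) and `dis n m ≤ C_{s'} s'^m` for every `s' > s`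
  (eigenvalue `1` is simple because every state reaches `free` in one step; invariant complement
  `range (U - 1)`; Gelfand's formula).
* S2b `stub_relaxationLower` (M/L) — for every unmarked eigenpair `μ ≠ 1`: `c ‖μ‖^m ≤ dis n m` (monotone grand
  coupling: `free ≤ x ≤ alljoined` pathwise, every function is a difference of two monotone ones).
* K `stub_kacGapAsymptotics` (open-problem; the lead's) — `EscapeRateKac ∧ RelaxationRateKac` (S3 ∧ S4).
Glue proved below (no `sorry`): S1 from D1, D2, S1'; S2 from D3, S2a, S2b and the landed Negative lemma
`pTwo_ge` (`s ≥ 1/8 > 0`) via `tendsto_rate_of_geometric_bounds`; the crux from S1, S2, K as before.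
-/

/-! ### Counting vocabulary (readable local names; the registered stubs inline all of them) -/

/-- The free state as a planar state. -/
def freeP (n : ℕ) : PlanarRowState (cols n) := ⟨RowState.free (cols n), RowState.isPlanar_free (cols n)⟩

/-- The ALLJOINED state: all sites in one class, `⋆` apart (one step from `free` with every bond open). -/
def alljoined (n : ℕ) : PlanarRowState (cols n) := planarRowStep Finset.univ (hEdges (cols n)) (freeP n)

/-- Iterate the deterministic row steps of a sequence of bond configurations (time `0` first). -/
def iter {n m : ℕ} (seq : Fin m → Finset (cols n) × Finset (cols n)) (p : PlanarRowState (cols n)) :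
    PlanarRowState (cols n) :=
  (List.ofFn seq).foldl (fun r OH => planarRowStep OH.1 OH.2 r) p

/-- The admissible sequences of length `m`: `(O_t, H_t)` with `H_t ⊆ hEdges S` (normalisation of
`PercolationRowTransfer`). -/
def seqs (n m : ℕ) : Finset (Fin m → Finset (cols n) × Finset (cols n)) :=
  Fintype.piFinset fun _ : Fin m => (Finset.univ : Finset (Finset (cols n))) ×ˢ (hEdges (cols n)).powerset

/-- The total weight `(2^{|S|} 2^{|hEdges S|})^m`. -/
def total (n m : ℕ) : ℝ := ((2 : ℝ) ^ (cols n).card * 2 ^ (hEdges (cols n)).card) ^ m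

/-- `cnt₁ n m`: fraction of sequences whose iterate from `wired` is MARKED (some site joined to `⋆`). -/
def cnt₁ (n m : ℕ) : ℝ :=
  (((seqs n m).filter fun seq => ∃ x, (iter seq (PlanarRowState.wired (cols n))).1.JoinedToStar x).card : ℝ) /
    total n m

/-- `dis n m`: fraction of sequences on which the iterates from `alljoined` and from `free` DISAGREE. -/
def dis (n m : ℕ) : ℝ :=
  (((seqs n m).filter fun seq => iter seq (alljoined n) ≠ iter seq (freeP n)).card : ℝ) / total n m

/-! ### Named statements of the reshaped stubs -/

/-- D1 · ONE-CLUSTER DICTIONARY (row-transfer exactness for the one-arc readout). -/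
def OneClusterDictionary : Prop := ∀ m n : ℕ, crossingProb half m n = cnt₁ n m

/-- D2 · PLANAR REACHABILITY: marked planar states are iterates of `wired`, unmarked ones of `free`. -/
def PlanarReachable : Prop :=
  (∀ (n : ℕ) (q : PlanarRowState (cols n)), (∃ x, q.1.JoinedToStar x) →
    ∃ l : List (Finset (cols n) × Finset (cols n)),
      l.foldl (fun r OH => planarRowStep OH.1 OH.2 r) (PlanarRowState.wired (cols n)) = q) ∧
  (∀ (n : ℕ) (q : PlanarRowState (cols n)), (∀ x, ¬ q.1.JoinedToStar x) →
    ∃ l : List (Finset (cols n) × Finset (cols n)),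
      l.foldl (fun r OH => planarRowStep OH.1 OH.2 r) (freeP n) = q)

/-- S1' · ONE-CLUSTER SPECTRAL STEP: D1 and the marked half of D2 give S1. -/
def OneClusterSpectral : Prop :=
  OneClusterDictionary →
  (∀ (n : ℕ) (q : PlanarRowState (cols n)), (∃ x, q.1.JoinedToStar x) →
    ∃ l : List (Finset (cols n) × Finset (cols n)),
      l.foldl (fun r OH => planarRowStep OH.1 OH.2 r) (PlanarRowState.wired (cols n)) = q) →
  OneClusterRateIsEscapeRate

/-- D3 · TWO-CLUSTER DICTIONARY: `p₂(m,n)` is two-sided comparable with the coupling disagreement `dis n m`. -/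
def TwoClusterDictionary : Prop :=
  ∀ n : ℕ, 1 ≤ n → ∃ c : ℝ, 0 < c ∧ ∀ m : ℕ,
    c * dis n m ≤ (bondPercolation (zdGraph 2) half).real (twoClusterEvent m n) ∧
    (bondPercolation (zdGraph 2) half).real (twoClusterEvent m n) ≤ dis n m

/-- S2a · RELAXATION UPPER: the unmarked block has an SLEM `s` and `dis n m ≤ C s'^m` for every `s' > s`. -/
def RelaxationUpper : Prop :=
  ∀ n : ℕ, 1 ≤ n → ∃ s : ℝ, IsRelaxationModulus n s ∧
    ∀ s' : ℝ, s < s' → ∃ C : ℝ, ∀ m : ℕ, dis n m ≤ C * s' ^ m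

/-- S2b · RELAXATION LOWER: every unmarked eigenvalue `μ ≠ 1` is seen by the disagreement: `c‖μ‖^m ≤ dis`. -/
def RelaxationLower : Prop :=
  ∀ n : ℕ, 1 ≤ n → ∀ (μ : ℂ) (v : PlanarRowState (cols n) → ℂ), IsUnmarkedEigenpair n μ v → μ ≠ 1 →
    ∃ c : ℝ, 0 < c ∧ ∀ m : ℕ, c * ‖μ‖ ^ m ≤ dis n m

/-- K · KAC GAP ASYMPTOTICS (`d = 2, 4`): S3 ∧ S4 — the open core of the crux. -/
def KacGapAsymptotics : Prop := EscapeRateKac ∧ RelaxationRateKac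

/-! ## Registered stubs (`sorry` lives only in these seven theorems; statements inline the named `def`s
over tree vocabulary: `cols n ↦ Finset.Icc (0 : ℤ) n`, `freeP`, `alljoined`, `iter`, `seqs`, `total`,
`cnt₁`, `dis` and the eigenpair / modulus predicates expanded) -/

/-- **D1** `= OneClusterDictionary` (see its docstring and the module docstring). Size L. -/
theorem stub_oneClusterDictionary :
    ∀ m n : ℕ, crossingProb half m n =
      ((((Fintype.piFinset fun _ : Fin m =>
            (Finset.univ : Finset (Finset (Finset.Icc (0 : ℤ) n))) ×ˢ (hEdges (Finset.Icc (0 : ℤ) n)).powerset).filter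
          fun seq => ∃ x, ((List.ofFn seq).foldl (fun r OH => planarRowStep OH.1 OH.2 r)
            (PlanarRowState.wired (Finset.Icc (0 : ℤ) n))).1.JoinedToStar x).card : ℝ) /
        ((2 : ℝ) ^ (Finset.Icc (0 : ℤ) n).card * 2 ^ (hEdges (Finset.Icc (0 : ℤ) n)).card) ^ m) := by
  sorry

/-- **D2** `= PlanarReachable`. Size L. -/
theorem stub_planarReachable :
    (∀ (n : ℕ) (q : PlanarRowState (Finset.Icc (0 : ℤ) n)), (∃ x, q.1.JoinedToStar x) →
      ∃ l : List (Finset (Finset.Icc (0 : ℤ) n) × Finset (Finset.Icc (0 : ℤ) n)),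
        l.foldl (fun r OH => planarRowStep OH.1 OH.2 r) (PlanarRowState.wired (Finset.Icc (0 : ℤ) n)) = q) ∧
    (∀ (n : ℕ) (q : PlanarRowState (Finset.Icc (0 : ℤ) n)), (∀ x, ¬ q.1.JoinedToStar x) →
      ∃ l : List (Finset (Finset.Icc (0 : ℤ) n) × Finset (Finset.Icc (0 : ℤ) n)),
        l.foldl (fun r OH => planarRowStep OH.1 OH.2 r)
          ⟨RowState.free (Finset.Icc (0 : ℤ) n), RowState.isPlanar_free (Finset.Icc (0 : ℤ) n)⟩ = q) := by
  sorry

/-- **S1'** `= OneClusterSpectral`. Size M. -/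
theorem stub_oneClusterSpectral :
    (∀ m n : ℕ, crossingProb half m n =
      ((((Fintype.piFinset fun _ : Fin m =>
            (Finset.univ : Finset (Finset (Finset.Icc (0 : ℤ) n))) ×ˢ (hEdges (Finset.Icc (0 : ℤ) n)).powerset).filter
          fun seq => ∃ x, ((List.ofFn seq).foldl (fun r OH => planarRowStep OH.1 OH.2 r)
            (PlanarRowState.wired (Finset.Icc (0 : ℤ) n))).1.JoinedToStar x).card : ℝ) /
        ((2 : ℝ) ^ (Finset.Icc (0 : ℤ) n).card * 2 ^ (hEdges (Finset.Icc (0 : ℤ) n)).card) ^ m)) →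
    (∀ (n : ℕ) (q : PlanarRowState (Finset.Icc (0 : ℤ) n)), (∃ x, q.1.JoinedToStar x) →
      ∃ l : List (Finset (Finset.Icc (0 : ℤ) n) × Finset (Finset.Icc (0 : ℤ) n)),
        l.foldl (fun r OH => planarRowStep OH.1 OH.2 r) (PlanarRowState.wired (Finset.Icc (0 : ℤ) n)) = q) →
    ∀ n : ℕ, 1 ≤ n → ∃ γ : ℝ,
      Tendsto (fun m : ℕ ↦ -Real.log (crossingProb half m n) / (m : ℝ)) atTop (𝓝 γ) ∧
      ((∃ (μ : ℂ) (v : PlanarRowState (Finset.Icc (0 : ℤ) n) → ℂ),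
          (v ≠ 0 ∧ (∀ p, (∀ x, ¬ p.1.JoinedToStar x) → v p = 0) ∧
            ∀ p, (∃ x, p.1.JoinedToStar x) →
              ∑ q, (planarTransfer (Finset.Icc (0 : ℤ) n) p q : ℂ) * v q = μ * v p) ∧
          ‖μ‖ = Real.exp (-γ)) ∧
        ∀ (μ : ℂ) (v : PlanarRowState (Finset.Icc (0 : ℤ) n) → ℂ),
          (v ≠ 0 ∧ (∀ p, (∀ x, ¬ p.1.JoinedToStar x) → v p = 0) ∧
            ∀ p, (∃ x, p.1.JoinedToStar x) →
              ∑ q, (planarTransfer (Finset.Icc (0 : ℤ) n) p q : ℂ) * v q = μ * v p) →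
          ‖μ‖ ≤ Real.exp (-γ)) := by
  sorry

/-- **D3** `= TwoClusterDictionary`. Size L. -/
theorem stub_twoClusterDictionary :
    ∀ n : ℕ, 1 ≤ n → ∃ c : ℝ, 0 < c ∧ ∀ m : ℕ,
      c * ((((Fintype.piFinset fun _ : Fin m =>
              (Finset.univ : Finset (Finset (Finset.Icc (0 : ℤ) n))) ×ˢ (hEdges (Finset.Icc (0 : ℤ) n)).powerset).filter
            fun seq =>
              (List.ofFn seq).foldl (fun r OH => planarRowStep OH.1 OH.2 r)
                  (planarRowStep Finset.univ (hEdges (Finset.Icc (0 : ℤ) n))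
                    ⟨RowState.free (Finset.Icc (0 : ℤ) n), RowState.isPlanar_free (Finset.Icc (0 : ℤ) n)⟩) ≠
                (List.ofFn seq).foldl (fun r OH => planarRowStep OH.1 OH.2 r)
                  ⟨RowState.free (Finset.Icc (0 : ℤ) n), RowState.isPlanar_free (Finset.Icc (0 : ℤ) n)⟩).card : ℝ) /
          ((2 : ℝ) ^ (Finset.Icc (0 : ℤ) n).card * 2 ^ (hEdges (Finset.Icc (0 : ℤ) n)).card) ^ m)
        ≤ (bondPercolation (zdGraph 2) half).real
          {ω | ∃ x₁ ∈ (leftSide m n : Set (Site 2)), ∃ y₁ ∈ (rightSide m n : Set (Site 2)),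
            ∃ x₂ ∈ (leftSide m n : Set (Site 2)), ∃ y₂ ∈ (rightSide m n : Set (Site 2)),
              ω ∈ openConnIn (rectangle m n : Set (Site 2)) x₁ y₁ ∧
              ω ∈ openConnIn (rectangle m n : Set (Site 2)) x₂ y₂ ∧
              ω ∉ openConnIn (rectangle m n : Set (Site 2)) x₁ x₂} ∧
      (bondPercolation (zdGraph 2) half).real
          {ω | ∃ x₁ ∈ (leftSide m n : Set (Site 2)), ∃ y₁ ∈ (rightSide m n : Set (Site 2)),
            ∃ x₂ ∈ (leftSide m n : Set (Site 2)), ∃ y₂ ∈ (rightSide m n : Set (Site 2)),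
              ω ∈ openConnIn (rectangle m n : Set (Site 2)) x₁ y₁ ∧
              ω ∈ openConnIn (rectangle m n : Set (Site 2)) x₂ y₂ ∧
              ω ∉ openConnIn (rectangle m n : Set (Site 2)) x₁ x₂}
        ≤ ((((Fintype.piFinset fun _ : Fin m =>
              (Finset.univ : Finset (Finset (Finset.Icc (0 : ℤ) n))) ×ˢ (hEdges (Finset.Icc (0 : ℤ) n)).powerset).filter
            fun seq =>
              (List.ofFn seq).foldl (fun r OH => planarRowStep OH.1 OH.2 r)
                  (planarRowStep Finset.univ (hEdges (Finset.Icc (0 : ℤ) n))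
                    ⟨RowState.free (Finset.Icc (0 : ℤ) n), RowState.isPlanar_free (Finset.Icc (0 : ℤ) n)⟩) ≠
                (List.ofFn seq).foldl (fun r OH => planarRowStep OH.1 OH.2 r)
                  ⟨RowState.free (Finset.Icc (0 : ℤ) n), RowState.isPlanar_free (Finset.Icc (0 : ℤ) n)⟩).card : ℝ) /
          ((2 : ℝ) ^ (Finset.Icc (0 : ℤ) n).card * 2 ^ (hEdges (Finset.Icc (0 : ℤ) n)).card) ^ m) := by
  sorry

/-- **S2a** `= RelaxationUpper`. Size L. -/
theorem stub_relaxationUpper :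
    ∀ n : ℕ, 1 ≤ n → ∃ s : ℝ,
      ((∃ (μ : ℂ) (v : PlanarRowState (Finset.Icc (0 : ℤ) n) → ℂ),
          (v ≠ 0 ∧ (∀ p, (∃ x, p.1.JoinedToStar x) → v p = 0) ∧
            ∀ p, (∀ x, ¬ p.1.JoinedToStar x) →
              ∑ q, (planarTransfer (Finset.Icc (0 : ℤ) n) p q : ℂ) * v q = μ * v p) ∧
          μ ≠ 1 ∧ ‖μ‖ = s) ∧
        ∀ (μ : ℂ) (v : PlanarRowState (Finset.Icc (0 : ℤ) n) → ℂ),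
          (v ≠ 0 ∧ (∀ p, (∃ x, p.1.JoinedToStar x) → v p = 0) ∧
            ∀ p, (∀ x, ¬ p.1.JoinedToStar x) →
              ∑ q, (planarTransfer (Finset.Icc (0 : ℤ) n) p q : ℂ) * v q = μ * v p) →
          μ ≠ 1 → ‖μ‖ ≤ s) ∧
      ∀ s' : ℝ, s < s' → ∃ C : ℝ, ∀ m : ℕ,
        ((((Fintype.piFinset fun _ : Fin m =>
              (Finset.univ : Finset (Finset (Finset.Icc (0 : ℤ) n))) ×ˢ (hEdges (Finset.Icc (0 : ℤ) n)).powerset).filter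
            fun seq =>
              (List.ofFn seq).foldl (fun r OH => planarRowStep OH.1 OH.2 r)
                  (planarRowStep Finset.univ (hEdges (Finset.Icc (0 : ℤ) n))
                    ⟨RowState.free (Finset.Icc (0 : ℤ) n), RowState.isPlanar_free (Finset.Icc (0 : ℤ) n)⟩) ≠
                (List.ofFn seq).foldl (fun r OH => planarRowStep OH.1 OH.2 r)
                  ⟨RowState.free (Finset.Icc (0 : ℤ) n), RowState.isPlanar_free (Finset.Icc (0 : ℤ) n)⟩).card : ℝ) /
          ((2 : ℝ) ^ (Finset.Icc (0 : ℤ) n).card * 2 ^ (hEdges (Finset.Icc (0 : ℤ) n)).card) ^ m)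
        ≤ C * s' ^ m := by
  sorry

/-- **S2b** `= RelaxationLower`. Size M/L. -/
theorem stub_relaxationLower :
    ∀ n : ℕ, 1 ≤ n → ∀ (μ : ℂ) (v : PlanarRowState (Finset.Icc (0 : ℤ) n) → ℂ),
      (v ≠ 0 ∧ (∀ p, (∃ x, p.1.JoinedToStar x) → v p = 0) ∧
        ∀ p, (∀ x, ¬ p.1.JoinedToStar x) →
          ∑ q, (planarTransfer (Finset.Icc (0 : ℤ) n) p q : ℂ) * v q = μ * v p) → μ ≠ 1 →
      ∃ c : ℝ, 0 < c ∧ ∀ m : ℕ,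
        c * ‖μ‖ ^ m ≤
          ((((Fintype.piFinset fun _ : Fin m =>
              (Finset.univ : Finset (Finset (Finset.Icc (0 : ℤ) n))) ×ˢ (hEdges (Finset.Icc (0 : ℤ) n)).powerset).filter
            fun seq =>
              (List.ofFn seq).foldl (fun r OH => planarRowStep OH.1 OH.2 r)
                  (planarRowStep Finset.univ (hEdges (Finset.Icc (0 : ℤ) n))
                    ⟨RowState.free (Finset.Icc (0 : ℤ) n), RowState.isPlanar_free (Finset.Icc (0 : ℤ) n)⟩) ≠
                (List.ofFn seq).foldl (fun r OH => planarRowStep OH.1 OH.2 r)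
                  ⟨RowState.free (Finset.Icc (0 : ℤ) n), RowState.isPlanar_free (Finset.Icc (0 : ℤ) n)⟩).card : ℝ) /
          ((2 : ℝ) ^ (Finset.Icc (0 : ℤ) n).card * 2 ^ (hEdges (Finset.Icc (0 : ℤ) n)).card) ^ m) := by
  sorry

/-- **K — the lead's stub (open problem; S3 ∧ S4 of the planner's skeleton)** `= KacGapAsymptotics`. -/
theorem stub_kacGapAsymptotics :
    (∀ r : ℕ → ℝ,
      (∀ n : ℕ, 1 ≤ n →
        (∃ (μ : ℂ) (v : PlanarRowState (Finset.Icc (0 : ℤ) n) → ℂ),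
            (v ≠ 0 ∧ (∀ p, (∀ x, ¬ p.1.JoinedToStar x) → v p = 0) ∧
              ∀ p, (∃ x, p.1.JoinedToStar x) →
                ∑ q, (planarTransfer (Finset.Icc (0 : ℤ) n) p q : ℂ) * v q = μ * v p) ∧
            ‖μ‖ = r n) ∧
          ∀ (μ : ℂ) (v : PlanarRowState (Finset.Icc (0 : ℤ) n) → ℂ),
            (v ≠ 0 ∧ (∀ p, (∀ x, ¬ p.1.JoinedToStar x) → v p = 0) ∧
              ∀ p, (∃ x, p.1.JoinedToStar x) →
                ∑ q, (planarTransfer (Finset.Icc (0 : ℤ) n) p q : ℂ) * v q = μ * v p) →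
            ‖μ‖ ≤ r n) →
      Tendsto (fun n : ℕ ↦ (n : ℝ) * -Real.log (r n)) atTop (𝓝 (Real.pi / 3))) ∧
    (∀ s : ℕ → ℝ,
      (∀ n : ℕ, 1 ≤ n →
        (∃ (μ : ℂ) (v : PlanarRowState (Finset.Icc (0 : ℤ) n) → ℂ),
            (v ≠ 0 ∧ (∀ p, (∃ x, p.1.JoinedToStar x) → v p = 0) ∧
              ∀ p, (∀ x, ¬ p.1.JoinedToStar x) →
                ∑ q, (planarTransfer (Finset.Icc (0 : ℤ) n) p q : ℂ) * v q = μ * v p) ∧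
            μ ≠ 1 ∧ ‖μ‖ = s n) ∧
          ∀ (μ : ℂ) (v : PlanarRowState (Finset.Icc (0 : ℤ) n) → ℂ),
            (v ≠ 0 ∧ (∀ p, (∃ x, p.1.JoinedToStar x) → v p = 0) ∧
              ∀ p, (∀ x, ¬ p.1.JoinedToStar x) →
                ∑ q, (planarTransfer (Finset.Icc (0 : ℤ) n) p q : ℂ) * v q = μ * v p) →
            μ ≠ 1 → ‖μ‖ ≤ s n) →
      Tendsto (fun n : ℕ ↦ (n : ℝ) * -Real.log (s n)) atTop (𝓝 (2 * Real.pi))) := by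
  sorry

/-! ### Consistency: each named statement IS its registered stub (definitionally) -/

theorem oneClusterDictionary_holds : OneClusterDictionary := fun m n => stub_oneClusterDictionary m n
theorem planarReachable_holds : PlanarReachable := stub_planarReachable
theorem oneClusterSpectral_holds : OneClusterSpectral := fun h₁ h₂ n hn => stub_oneClusterSpectral h₁ h₂ n hn
theorem twoClusterDictionary_holds : TwoClusterDictionary := fun n hn => stub_twoClusterDictionary n hn
theorem relaxationUpper_holds : RelaxationUpper := fun n hn => stub_relaxationUpper n hn
theorem relaxationLower_holds : RelaxationLower := fun n hn μ v h h1 => stub_relaxationLower n hn μ v h h1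
theorem kacGapAsymptotics_holds : KacGapAsymptotics :=
  ⟨fun r hr => stub_kacGapAsymptotics.1 r hr, fun s hs => stub_kacGapAsymptotics.2 s hs⟩

/-! ### Name-keyed aliases of the seven statements (the hypotheses of the composition) -/
namespace Registered

/-- Alias of `OneClusterDictionary` keyed by the registered stub name. -/
abbrev stub_oneClusterDictionary : Prop := OneClusterDictionary
/-- Alias of `PlanarReachable` keyed by the registered stub name. -/
abbrev stub_planarReachable : Prop := PlanarReachable
/-- Alias of `OneClusterSpectral` keyed by the registered stub name. -/
abbrev stub_oneClusterSpectral : Prop := OneClusterSpectral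
/-- Alias of `TwoClusterDictionary` keyed by the registered stub name. -/
abbrev stub_twoClusterDictionary : Prop := TwoClusterDictionary
/-- Alias of `RelaxationUpper` keyed by the registered stub name. -/
abbrev stub_relaxationUpper : Prop := RelaxationUpper
/-- Alias of `RelaxationLower` keyed by the registered stub name. -/
abbrev stub_relaxationLower : Prop := RelaxationLower
/-- Alias of `KacGapAsymptotics` keyed by the registered stub name. -/
abbrev stub_kacGapAsymptotics : Prop := KacGapAsymptotics

end Registered

/-! ## Proved glue (kernel-checked; nothing is admitted below this line) -/

/-- `n · -log (e^{-γ}) = n · γ`. -/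
theorem mul_neg_log_exp_neg (n γ : ℝ) : n * -Real.log (Real.exp (-γ)) = n * γ := by
  rw [Real.log_exp, neg_neg]

/-- **Rates from two-sided geometric bounds.** If `0 < a m`, `c s^m ≤ a m` for some `c > 0`, and
`a m ≤ C_{s'} s'^m` for every `s' > s > 0`, then `-log (a m)/m → -log s`. -/
theorem tendsto_rate_of_geometric_bounds {a : ℕ → ℝ} {s : ℝ} (hs : 0 < s) (ha : ∀ m, 0 < a m)
    (hlow : ∃ c : ℝ, 0 < c ∧ ∀ m, c * s ^ m ≤ a m)
    (hup : ∀ s' : ℝ, s < s' → ∃ C : ℝ, ∀ m, a m ≤ C * s' ^ m) :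
    Tendsto (fun m : ℕ => -Real.log (a m) / (m : ℝ)) atTop (𝓝 (-Real.log s)) := by
  rw [tendsto_order]
  constructor
  · -- lower estimate: eventually `b < -log (a m) / m` for every `b < -log s`
    intro b hb
    set b' : ℝ := (b + -Real.log s) / 2 with hb'
    have hbb' : b < b' := by rw [hb']; linarith
    have hb's : b' < -Real.log s := by rw [hb']; linarith
    obtain ⟨C, hC⟩ := hup (Real.exp (-b')) (by
      calc s = Real.exp (Real.log s) := (Real.exp_log hs).symm
        _ < Real.exp (-b') := Real.exp_lt_exp.2 (by linarith))
    have hC0 : 0 < C := by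
      have h0 := hC 0
      simp only [pow_zero, mul_one] at h0
      exact (ha 0).trans_le h0
    -- `-log (a m)/m ≥ b' - log C / m`, and the right side tends to `b'`
    have hlim : Tendsto (fun m : ℕ => b' - Real.log C / (m : ℝ)) atTop (𝓝 (b' - 0)) :=
      tendsto_const_nhds.sub (tendsto_const_div_atTop_nhds_zero_nat (Real.log C))
    rw [sub_zero] at hlim
    have hev := (tendsto_order.1 hlim).1 b hbb'
    filter_upwards [hev, eventually_ge_atTop 1] with m hm hm1
    have hm0 : (0 : ℝ) < m := by exact_mod_cast hm1
    have hlog : Real.log (a m) ≤ Real.log C + m * -b' := by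
      have h1 := Real.log_le_log (ha m) (hC m)
      rw [Real.log_mul hC0.ne' (pow_ne_zero _ (Real.exp_pos _).ne'), Real.log_pow, Real.log_exp] at h1
      linarith
    calc b < b' - Real.log C / m := hm
      _ ≤ -Real.log (a m) / m := by
          rw [le_div_iff₀ hm0, sub_mul, div_mul_cancel₀ _ hm0.ne']
          linarith
  · -- upper estimate: eventually `-log (a m) / m < b` for every `b > -log s`
    intro b hb
    obtain ⟨c, hc, hca⟩ := hlow
    have hlim : Tendsto (fun m : ℕ => -Real.log s + -Real.log c / (m : ℝ)) atTop (𝓝 (-Real.log s + 0)) :=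
      tendsto_const_nhds.add (tendsto_const_div_atTop_nhds_zero_nat (-Real.log c))
    rw [add_zero] at hlim
    have hev := (tendsto_order.1 hlim).2 b hb
    filter_upwards [hev, eventually_ge_atTop 1] with m hm hm1
    have hm0 : (0 : ℝ) < m := by exact_mod_cast hm1
    have hlog : Real.log c + m * Real.log s ≤ Real.log (a m) := by
      have h1 := Real.log_le_log (mul_pos hc (pow_pos hs m)) (hca m)
      rwa [Real.log_mul hc.ne' (pow_ne_zero _ hs.ne'), Real.log_pow] at h1
    calc -Real.log (a m) / m ≤ -Real.log s + -Real.log c / m := by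
          rw [div_le_iff₀ hm0, add_mul, div_mul_cancel₀ _ hm0.ne']
          linarith
      _ < b := hm

/-- **S1 from the reshaped stubs** D1, D2 (marked half), S1'. -/
theorem oneClusterRateIsEscapeRate_of (hD1 : Registered.stub_oneClusterDictionary)
    (hD2 : Registered.stub_planarReachable) (hS1 : Registered.stub_oneClusterSpectral) :
    OneClusterRateIsEscapeRate :=
  hS1 hD1 hD2.1

/-- `p₂(m,n) > 0` for `n ≥ 1` (landed Negative lemma `pTwo_ge`: the ladder configuration). -/
theorem pTwo_pos {m n : ℕ} (hn : 1 ≤ n) :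
    0 < (bondPercolation (zdGraph 2) half).real (twoClusterEvent m n) :=
  lt_of_lt_of_le (by positivity)
    (Summit.CriticalPhenomena.CardyFormulaZ2.Theorems.StripClusterRates.Negative.pTwo_ge (m := m) hn)

/-- **S2 from the reshaped stubs** D3, S2a, S2b (and `pTwo_ge` for `s > 0`). -/
theorem twoClusterRateIsRelaxationRate_of (hD3 : Registered.stub_twoClusterDictionary)
    (hU : Registered.stub_relaxationUpper) (hL : Registered.stub_relaxationLower) :
    TwoClusterRateIsRelaxationRate := by
  intro n hn
  obtain ⟨s, hmod, hup⟩ := hU n hn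
  obtain ⟨⟨μ, v, hev, hμ1, hμs⟩, hdom⟩ := hmod
  obtain ⟨c, hc, hlow⟩ := hL n hn μ v hev hμ1
  obtain ⟨c', hc', hdict⟩ := hD3 n hn
  rw [hμs] at hlow
  -- two-sided geometric bounds for `p₂`
  have hlow' : ∀ m, c' * c * s ^ m ≤ (bondPercolation (zdGraph 2) half).real (twoClusterEvent m n) := by
    intro m
    calc c' * c * s ^ m = c' * (c * s ^ m) := by ring
      _ ≤ c' * dis n m := mul_le_mul_of_nonneg_left (hlow m) hc'.le
      _ ≤ _ := (hdict m).1
  have hup' : ∀ s' : ℝ, s < s' → ∃ C : ℝ, ∀ m,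
      (bondPercolation (zdGraph 2) half).real (twoClusterEvent m n) ≤ C * s' ^ m := by
    intro s' hs'
    obtain ⟨C, hC⟩ := hup s' hs'
    exact ⟨C, fun m => ((hdict m).2).trans (hC m)⟩
  -- `s > 0`: otherwise `p₂ ≤ C (1/16)^m` contradicts `p₂ ≥ (1/2)(1/8)^m`
  have hs0 : 0 ≤ s := by rw [← hμs]; exact norm_nonneg μ
  have hs : 0 < s := by
    by_contra hneg
    have hs00 : s = 0 := le_antisymm (not_lt.1 hneg) hs0
    obtain ⟨C, hC⟩ := hup' (1 / 16) (by rw [hs00]; norm_num)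
    have hC0 : 0 < C := by
      have h0 := (pTwo_pos (m := 0) hn).trans_le (hC 0)
      simpa using h0
    -- `(1/2)^(3m+1) ≤ C (1/16)^m`, i.e. `2^m ≤ 2C`, fails for large `m`
    have key : ∀ m : ℕ, (2 : ℝ) ^ m ≤ 2 * C := by
      intro m
      have h1 := (Summit.CriticalPhenomena.CardyFormulaZ2.Theorems.StripClusterRates.Negative.pTwo_ge
        (m := m) hn).trans (hC m)
      have h2 : (1 / 2 : ℝ) ^ (3 * m + 1) = (2 : ℝ) ^ m * ((1 / 2) * (1 / 16 : ℝ) ^ m) := by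
        rw [pow_succ, pow_mul]
        have : ((1 / 2 : ℝ) ^ 3) = (2 : ℝ) * (1 / 16) := by norm_num
        rw [this, mul_pow]
        ring
      rw [h2] at h1
      have hpos : (0 : ℝ) < (1 / 2) * (1 / 16 : ℝ) ^ m := by positivity
      have h3 : (2 : ℝ) ^ m * ((1 / 2) * (1 / 16 : ℝ) ^ m) ≤ (2 * C) * ((1 / 2) * (1 / 16 : ℝ) ^ m) := by
        calc _ ≤ C * (1 / 16 : ℝ) ^ m := h1
          _ = (2 * C) * ((1 / 2) * (1 / 16 : ℝ) ^ m) := by ring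
      exact le_of_mul_le_mul_right h3 hpos
    obtain ⟨m, hm⟩ := pow_unbounded_of_one_lt (2 * C) (by norm_num : (1 : ℝ) < 2)
    exact absurd (key m) (not_le.2 hm)
  refine ⟨-Real.log s, ?_, ?_⟩
  · -- the rate
    have h := tendsto_rate_of_geometric_bounds (a := fun m => (bondPercolation (zdGraph 2) half).real
      (twoClusterEvent m n)) hs (fun m => pTwo_pos hn) ⟨c' * c, mul_pos hc' hc, hlow'⟩ hup'
    exact h
  · -- the modulus clause at `e^{-(-log s)} = s`
    rw [neg_neg, Real.exp_log hs]
    exact ⟨⟨μ, v, hev, hμ1, hμs⟩, hdom⟩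

/-- **Composition.** The seven registered stubs imply the crux `CardyBoundaryCoulombGas.StripClusterRates`,
concluded BY NAME: S1/S2 are assembled from the dictionary / reachability / spectral stubs
(`oneClusterRateIsEscapeRate_of`, `twoClusterRateIsRelaxationRate_of`), the rates `γ₁, γ₂` are CHOSEN from
them (junk `0` at width `0`), and K applied to the sequences `e^{-γ_k(n)}` gives `n·γ₁(n) → π/3`,
`n·γ₂(n) → 2π` after `Real.log_exp`. -/
theorem StripClusterRates_of (hD1 : Registered.stub_oneClusterDictionary)
    (hD2 : Registered.stub_planarReachable) (hS1 : Registered.stub_oneClusterSpectral)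
    (hD3 : Registered.stub_twoClusterDictionary) (hU : Registered.stub_relaxationUpper)
    (hL : Registered.stub_relaxationLower) (hK : Registered.stub_kacGapAsymptotics) :
    Summit.CriticalPhenomena.CardyFormulaZ2.Theses.CardyBoundaryCoulombGas.StripClusterRates := by
  have h₁ : OneClusterRateIsEscapeRate := oneClusterRateIsEscapeRate_of hD1 hD2 hS1
  have h₂ : TwoClusterRateIsRelaxationRate := twoClusterRateIsRelaxationRate_of hD3 hU hL
  obtain ⟨h₃, h₄⟩ := hK
  -- the rates, chosen from S1 / S2 at widths `n ≥ 1` (junk value `0` at width `0`)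
  let γ₁ : ℕ → ℝ := fun n => if hn : 1 ≤ n then (h₁ n hn).choose else 0
  let γ₂ : ℕ → ℝ := fun n => if hn : 1 ≤ n then (h₂ n hn).choose else 0
  have hγ₁ : ∀ n : ℕ, ∀ hn : 1 ≤ n, γ₁ n = (h₁ n hn).choose := fun n hn => dif_pos hn
  have hγ₂ : ∀ n : ℕ, ∀ hn : 1 ≤ n, γ₂ n = (h₂ n hn).choose := fun n hn => dif_pos hn
  refine ⟨γ₁, γ₂, ?_, ?_, ?_, ?_⟩
  · intro n hn
    rw [hγ₁ n hn]
    exact (h₁ n hn).choose_spec.1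
  · intro n hn
    rw [hγ₂ n hn]
    exact (h₂ n hn).choose_spec.1
  · have hr : ∀ n : ℕ, 1 ≤ n → IsEscapeModulus n (Real.exp (-γ₁ n)) := by
      intro n hn
      rw [hγ₁ n hn]
      exact (h₁ n hn).choose_spec.2
    have h := h₃ (fun n => Real.exp (-γ₁ n)) hr
    refine h.congr' (Eventually.of_forall fun n => ?_)
    exact mul_neg_log_exp_neg n (γ₁ n)
  · have hs : ∀ n : ℕ, 1 ≤ n → IsRelaxationModulus n (Real.exp (-γ₂ n)) := by
      intro n hn
      rw [hγ₂ n hn]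
      exact (h₂ n hn).choose_spec.2
    have h := h₄ (fun n => Real.exp (-γ₂ n)) hs
    refine h.congr' (Eventually.of_forall fun n => ?_)
    exact mul_neg_log_exp_neg n (γ₂ n)

/-- The closed form over the seven registered stubs (an `example`, so that `StripClusterRates_of` stays the
only theorem of the file concluding the crux). -/
example : Summit.CriticalPhenomena.CardyFormulaZ2.Theses.CardyBoundaryCoulombGas.StripClusterRates :=
  StripClusterRates_of stub_oneClusterDictionary stub_planarReachable stub_oneClusterSpectral
    stub_twoClusterDictionary stub_relaxationUpper stub_relaxationLower stub_kacGapAsymptotics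

end Summit.CriticalPhenomena.CardyFormulaZ2.Cruxes.StripClusterRates.TwoClusterRateIsStationaryGap

end
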